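import Mathlib.Algebra.Category.ModuleCat.Differentials.Presheaf
import Literature.AlgebraicGeometry.Motives.HodgeSheaves
import Literature.AlgebraicGeometry.Crystalline.KaehlerDeRhamComplexNaturality
import HarnessLib

/-!
# The presheaf of algebraic de Rham complexes of a morphism of presheaves of rings

For a morphism `φ : S ⟶ R` of presheaves of commutative rings on a category `D` (e.g. the structure
morphism `k → 𝒪_X` of a `k`-scheme, the tree's `Motives.constToPresheaf X`), Mathlib constructs the
presheaf of `R`-modules of relative Kähler differentials
`Ω¹ = PresheafOfModules.DifferentialsConstruction.relativeDifferentials' φ` (`U ↦ Ω[R(U)⁄S(U)]`), and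
the tree (`Motives/HodgeSheaves`) its exterior powers `Ωⁿ = exteriorPowerPresheaf Ω¹ n`
(`U ↦ ⋀ⁿ_{R(U)} Ω[R(U)⁄S(U)]`). This file adds the exterior derivative between them.

Bundled, single-morphism level (`f : A ⟶ B` in `CommRingCat`, as Mathlib's
`CommRingCat.KaehlerDifferential f`):
* `homForms f n : Ab` — the `n`-forms `⋀ⁿ_B Ω[B⁄A]`; `homD f n : homForms f n ⟶ homForms f (n + 1)` —
  the exterior derivative (`Crystalline/KaehlerDeRhamComplex`), `homD_comp_homD : d ≫ d = 0`;
* `homMap fac n : homForms f n ⟶ homForms f' n` for a commutative square `fac : g ≫ f' = f ≫ g'` —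
  the pull-back of `n`-forms (`Crystalline/KaehlerDeRhamComplexNaturality.formsMapDegree`), with
  `homMap_comp_homD` (naturality of `d`) and `homMap_eq_exteriorPowerMap'` (it IS the tree's
  restriction map `exteriorPowerMap'` of Mathlib's `CommRingCat.KaehlerDifferential.map fac`).

Presheaf level:
* `formsPresheaf φ n : Dᵒᵖ ⥤ Ab` — the presheaf of ABELIAN GROUPS underlying `Ωⁿ` (the de Rham
  differential is not `R`-linear, so the complex lives in presheaves of abelian groups);
* `deRhamDifferential φ n : formsPresheaf φ n ⟶ formsPresheaf φ (n + 1)` and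
* `deRhamComplexPresheaf φ : CochainComplex (Dᵒᵖ ⥤ Ab) ℕ` — **the presheaf of algebraic de Rham
  complexes** `U ↦ (⋀•_{R(U)} Ω[R(U)⁄S(U)], d)`.

Sources: EGA IV₄ (Publ. IHÉS 32, 1967) 16.6 (the complex `Ω•_{X/S}` and its functoriality);
R. Hartshorne, *Algebraic Geometry* (1977), III.7 p. 225; The Stacks project, Tag 0FKL (the de Rham
complex of a morphism of schemes is the sheafification of the naive presheaf one). [folklore]
Everything is proved; no named facts. NOT here: sheafification and the comparison of the terms
with `Motives.hodgeSheaf` (sequel), hypercohomology (`Crystalline/SheafHypercohomology`).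
-/

noncomputable section

namespace Literature.AlgebraicGeometry.Crystalline

open CategoryTheory Literature.AlgebraicGeometry.Motives KaehlerExteriorDerivative

universe v₁ u₁ u

namespace DeRhamComplexPresheaf

/-! ### Bundled form: one morphism `f : A ⟶ B` of `CommRingCat` -/

section Hom

variable {A B A' B' : CommRingCat.{u}} (f : A ⟶ B) {f' : A' ⟶ B'} {g : A ⟶ A'} {g' : B ⟶ B'}

/-- The abelian group of `n`-forms `⋀ⁿ_B Ω[B⁄A]` of a morphism `f : A ⟶ B` in `CommRingCat`
(for the algebra structure `f.hom.toAlgebra`, as Mathlib's `CommRingCat.KaehlerDifferential f`).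
[folklore] -/
def homForms (n : ℕ) : Ab.{u} :=
  letI := f.hom.toAlgebra
  AddCommGrpCat.of (⋀[B]^n (Ω[B⁄A]))

/-- The exterior derivative `d : ⋀ⁿ Ω[B⁄A] → ⋀ⁿ⁺¹ Ω[B⁄A]` of `f : A ⟶ B`, as a morphism of abelian
groups (`KaehlerExteriorDerivative.kaehlerExteriorDerivative`). [folklore] -/
def homD (n : ℕ) : homForms f n ⟶ homForms f (n + 1) :=
  letI := f.hom.toAlgebra
  AddCommGrpCat.ofHom (kaehlerExteriorDerivative A B n).toAddMonoidHom

/-- `d ≫ d = 0`. [folklore] -/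
theorem homD_comp_homD (n : ℕ) : homD f n ≫ homD f (n + 1) = 0 := by
  letI := f.hom.toAlgebra
  apply AddCommGrpCat.hom_ext
  exact congrArg LinearMap.toAddMonoidHom (kaehlerExteriorDerivative_comp A B n)

variable {f}

/-- The pull-back of `n`-forms `⋀ⁿ_B Ω[B⁄A] → ⋀ⁿ_{B'} Ω[B'⁄A']` along a commutative square
`fac : g ≫ f' = f ≫ g'` in `CommRingCat` (`KaehlerExteriorDerivative.formsMapDegree` for the algebra
structures given by `f, f', g, g', g ≫ f'`, as in Mathlib's `CommRingCat.KaehlerDifferential.map`).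
[folklore] -/
def homMap (fac : g ≫ f' = f ≫ g') (n : ℕ) : homForms f n ⟶ homForms f' n :=
  letI := f.hom.toAlgebra
  letI := f'.hom.toAlgebra
  letI := g.hom.toAlgebra
  letI := g'.hom.toAlgebra
  letI := (g ≫ f').hom.toAlgebra
  haveI : IsScalarTower A A' B' := IsScalarTower.of_algebraMap_eq' rfl
  haveI : IsScalarTower A B B' := IsScalarTower.of_algebraMap_eq' (congrArg CommRingCat.Hom.hom fac)
  AddCommGrpCat.ofHom (formsMapDegree A A' B B' n).toAddMonoidHom

/-- **Naturality of the exterior derivative** along a commutative square in `CommRingCat`: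
`homMap ≫ d = d ≫ homMap`. [folklore] -/
theorem homMap_comp_homD (fac : g ≫ f' = f ≫ g') (n : ℕ) :
    homMap fac n ≫ homD f' n = homD f n ≫ homMap fac (n + 1) := by
  letI := f.hom.toAlgebra
  letI := f'.hom.toAlgebra
  letI := g.hom.toAlgebra
  letI := g'.hom.toAlgebra
  letI := (g ≫ f').hom.toAlgebra
  haveI : IsScalarTower A A' B' := IsScalarTower.of_algebraMap_eq' rfl
  haveI : IsScalarTower A B B' := IsScalarTower.of_algebraMap_eq' (congrArg CommRingCat.Hom.hom fac)
  apply AddCommGrpCat.hom_ext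
  exact (formsMapDegree_comp_kaehlerExteriorDerivative_toAddMonoidHom A A' B B' n).symm

/-- `homMap fac n` is the map on `n`-th exterior powers induced (the tree's `exteriorPowerMap'`) by
Mathlib's `CommRingCat.KaehlerDifferential.map fac` — i.e. the restriction map of the presheaf of
`n`-forms. (Uniqueness of the pull-back on pure wedges, `eq_formsMapDegree_of_ιMulti`.) [folklore] -/
theorem homMap_eq_exteriorPowerMap' (fac : g ≫ f' = f ≫ g') (n : ℕ) :
    homMap fac n = AddCommGrpCat.ofHom
      (exteriorPowerMap' (CommRingCat.KaehlerDifferential.map fac) n).hom.toAddMonoidHom := by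
  letI := f.hom.toAlgebra
  letI := f'.hom.toAlgebra
  letI := g.hom.toAlgebra
  letI := g'.hom.toAlgebra
  letI := (g ≫ f').hom.toAlgebra
  haveI : IsScalarTower A A' B' := IsScalarTower.of_algebraMap_eq' rfl
  haveI : IsScalarTower A B B' := IsScalarTower.of_algebraMap_eq' (congrArg CommRingCat.Hom.hom fac)
  apply AddCommGrpCat.hom_ext
  symm
  refine AddMonoidHom.ext fun x ↦ eq_formsMapDegree_of_ιMulti A A' B B' n _ (fun b y ↦ ?_)
    (fun v ↦ ?_) x
  · exact ((exteriorPowerMap' (CommRingCat.KaehlerDifferential.map fac) n).hom.map_smul b y).trans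
      rfl
  · exact exteriorPowerMap'_mk (CommRingCat.KaehlerDifferential.map fac) v

end Hom

/-! ### The presheaf of de Rham complexes -/

variable {D : Type u₁} [Category.{v₁} D] {S R : Dᵒᵖ ⥤ CommRingCat.{u}} (φ : S ⟶ R)

/-- The presheaf of `R`-modules of `n`-forms `Ωⁿ = ⋀ⁿ Ω¹` of `φ : S ⟶ R`
(`U ↦ ⋀ⁿ_{R(U)} Ω[R(U)⁄S(U)]`): the tree's `exteriorPowerPresheaf` of Mathlib's
`relativeDifferentials' φ`. [folklore] -/
abbrev formsPresheafOfModules (n : ℕ) : PresheafOfModules.{u} (R ⋙ forget₂ _ _) :=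
  exteriorPowerPresheaf (PresheafOfModules.DifferentialsConstruction.relativeDifferentials' φ) n

/-- The presheaf of abelian groups of `n`-forms (underlying `formsPresheafOfModules φ n`).
[folklore] -/
abbrev formsPresheaf (n : ℕ) : Dᵒᵖ ⥤ Ab.{u} := (formsPresheafOfModules φ n).presheaf

/-- The sections of `formsPresheaf φ n` over `U` are the bundled `n`-forms of `φ.app U`
(definitionally). [folklore] -/
theorem formsPresheaf_obj (U : Dᵒᵖ) (n : ℕ) : (formsPresheaf φ n).obj U = homForms (φ.app U) n :=
  rfl

/-- The restriction maps of `formsPresheaf φ n` are the bundled pull-backs `homMap` (of the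
naturality squares of `φ`). [folklore] -/
theorem formsPresheaf_map {U V : Dᵒᵖ} (i : U ⟶ V) (n : ℕ) :
    (formsPresheaf φ n).map i = homMap (φ.naturality i) n := by
  rw [homMap_eq_exteriorPowerMap']
  rfl

/-- The exterior derivative on sections over `U` (the bundled `homD` of `φ.app U`). [folklore] -/
def dApp (U : Dᵒᵖ) (n : ℕ) : (formsPresheaf φ n).obj U ⟶ (formsPresheaf φ (n + 1)).obj U :=
  homD (φ.app U) n

/-- `dApp` on an `n`-form is the exterior derivative. [folklore] -/
theorem dApp_apply (U : Dᵒᵖ) (n : ℕ) (x : (formsPresheaf φ n).obj U) :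
    letI := (φ.app U).hom.toAlgebra
    dApp φ U n x = kaehlerExteriorDerivative (S.obj U) (R.obj U) n x :=
  rfl

/-- `d ≫ d = 0` on sections. [folklore] -/
theorem dApp_comp_dApp (U : Dᵒᵖ) (n : ℕ) : dApp φ U n ≫ dApp φ U (n + 1) = 0 :=
  homD_comp_homD (φ.app U) n

/-- **The exterior derivative commutes with restriction**: for `i : U ⟶ V` in `Dᵒᵖ`,
`d (x|_V) = (d x)|_V`. [folklore] -/
theorem dApp_naturality {U V : Dᵒᵖ} (i : U ⟶ V) (n : ℕ) :
    (formsPresheaf φ n).map i ≫ dApp φ V n = dApp φ U n ≫ (formsPresheaf φ (n + 1)).map i := by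
  rw [formsPresheaf_map, formsPresheaf_map]
  exact homMap_comp_homD (φ.naturality i) n

end DeRhamComplexPresheaf

open DeRhamComplexPresheaf

variable {D : Type u₁} [Category.{v₁} D] {S R : Dᵒᵖ ⥤ CommRingCat.{u}} (φ : S ⟶ R)

/-- The exterior derivative `d : Ωⁿ → Ωⁿ⁺¹` as a morphism of presheaves of abelian groups.
[folklore] -/
def deRhamDifferential (n : ℕ) : formsPresheaf φ n ⟶ formsPresheaf φ (n + 1) where
  app U := dApp φ U n
  naturality _ _ i := dApp_naturality φ i n

/-- The components of `deRhamDifferential` are the exterior derivatives on sections. [folklore] -/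
@[simp] theorem deRhamDifferential_app (n : ℕ) (U : Dᵒᵖ) :
    (deRhamDifferential φ n).app U = dApp φ U n := rfl

/-- `d ≫ d = 0` for the presheaf-level exterior derivative. [folklore] -/
theorem deRhamDifferential_comp (n : ℕ) :
    deRhamDifferential φ n ≫ deRhamDifferential φ (n + 1) = 0 := by
  ext U : 2
  exact dApp_comp_dApp φ U n

/-- **The presheaf of algebraic de Rham complexes** of `φ : S ⟶ R`: the cochain complex of
presheaves of abelian groups `R = Ω⁰ →ᵈ Ω¹ →ᵈ Ω² →ᵈ ⋯`, `U ↦ (⋀•_{R(U)} Ω[R(U)⁄S(U)], d)`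
(Mathlib's `CochainComplex.of`). For the structure morphism of a smooth `k`-scheme its
sheafification is the algebraic de Rham complex `Ω•_{X/k}`.
(EGA IV₄ 16.6; Hartshorne III.7 p. 225; Stacks 0FKL.) [folklore] -/
def deRhamComplexPresheaf : CochainComplex (Dᵒᵖ ⥤ Ab.{u}) ℕ :=
  CochainComplex.of (formsPresheaf φ) (deRhamDifferential φ) (deRhamDifferential_comp φ)

/-- The `n`-th term of the presheaf de Rham complex is the presheaf of `n`-forms. [folklore] -/
theorem deRhamComplexPresheaf_X (n : ℕ) : (deRhamComplexPresheaf φ).X n = formsPresheaf φ n := rfl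

/-- The differential of the presheaf de Rham complex is the exterior derivative. [folklore] -/
theorem deRhamComplexPresheaf_d (n : ℕ) :
    (deRhamComplexPresheaf φ).d n (n + 1) = deRhamDifferential φ n :=
  CochainComplex.of_d _ (deRhamDifferential φ) n

end Literature.AlgebraicGeometry.Crystalline

end
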